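import Literature.NumberTheory.Automorphic.HeckeDoubleCosetOperators
import Literature.NumberTheory.Automorphic.IwasawaDecompositionGL
import Literature.NumberTheory.Automorphic.ShintaniWhittakerFormula
import HarnessLib

/-!
# The Satake transform of `ℋ(GL_n(F), GL_n(𝒪))` as an algebra homomorphism to `ℂ[ℤⁿ]`

Topic `NumberTheory/Automorphic`.  Setting: a field `F` with a `ValuativeRel` whose valuation ring
`𝒪 = 𝒪[F]` is a discrete valuation ring with finite residue field `𝓀` of cardinality `q`
(e.g. a non-archimedean local field), a uniformizing element `ϖ`, `G = GL_n(F)`,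
`K = GL_n(𝒪) = glInt n F`, `U` the upper unitriangular matrices, and the Hecke algebra
`ℋ(G, K) = End_G(ℂ[G ⧸ K])` (`heckeAlgebra` of `HeckeAlgebra`) with its double-coset operators
`T_g = heckeAlgebra.doubleCosetOperator K g` (`HeckeDoubleCosetOperators`).  Everything is proved.

* `iwasawaExp hϖ g ∈ ℤⁿ`: the torus exponent `e(g)` of `g = u ϖ^{e(g)} k` (`u ∈ U`, `k ∈ K`),
  well defined by the Iwasawa decomposition with uniqueness (`IwasawaDecompositionGL`); it is a
  function of the coset `gK` (`iwasawaExp_mul_of_mem_glInt`) and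
  `e(u ϖ^m g) = m + e(g)` (`iwasawaExp_unipotent_mul_zpowDiagGL_mul`).
* `satakeTransform hϖ : ℋ(G, K) →ₐ[ℂ] ℂ[ℤⁿ]` (`AddMonoidAlgebra ℂ (Fin n → ℤ)`), the **Satake
  transform** in the discrete form
  `𝒮(T) = ∑_{γ ∈ G/K} (T [K])(γ) · q^{-⟨ν, e(γ)⟩} · x^{e(γ)}`, `ν = (n-1, n-2, …, 0)`
  (`satakeWeight`), i.e. for `T = T_g`: `𝒮(𝟙_{KgK})(x) = ∑_{yK ⊆ KgK} q^{-⟨ν, e(y)⟩} x^{e(y)}` —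
  Cartier's `(Sf)(t) = δ(t)^{1/2} ∫_U f(tu) du` (Corvallis 1979, §IV.2, (4.2.3)) evaluated on
  characteristic functions, in the normalisation `q^{-⟨ν, ·⟩} = δ^{1/2} · |det|^{(n-1)/2}` that
  keeps all exponents integral.  It is an **algebra homomorphism** (`map_mul`: the Iwasawa
  representatives `u ϖ^m` of the cosets multiply the exponents additively — Cartier, op. cit.,
  Thm. 4.1, step (a) of the proof; Satake (1963), §6).
* `satakeTransform_doubleCosetOperator_heckeDiag` (**the transform of `T_r`**): for `r ≤ n`,
  `𝒮(T_r) = q^{-r(r-1)/2} · e_r(x)`, `e_r(x) = ∑_{#t = r} x^{𝟙_t}` the elementary symmetric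
  Laurent polynomial — from the transversal `{u_a ϖ^{ε_S}}` of `K t_r K / K` (`bijOn_heckeTransversal`,
  `HeckeTransversalGL`), the count `#{a} = q^{c(S)}` and the exponent identity
  `c(S) - ∑_{i ∉ S} (n-1-i) = -r(r-1)/2` (`two_mul_card_echelonPositions_compl`,
  `ShintaniWhittakerFormula`).  This is Tamagawa's computation `ω(T_r) = q^{r(r-1)/2} e_r` up to
  the normalisation (Shimura (1971), Thm. 3.21; Macdonald (1995), Ch. V, (3.4): the Satake image of
  `c_{(1^r)}` is `q^{-r(r-1)/2}`-times... `e_r` up to the power `q^{r(n-r)/2}` of the unitary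
  normalisation; Cartier, op. cit., §IV.2, Example).

## References

* P. Cartier, *Representations of 𝔭-adic groups: a survey*, Proc. Sympos. Pure Math. 33 (1979),
  part 1, §IV.2, (4.2.3), Thm. 4.1 [CartierCorvallis1979].
* I. Satake, *Theory of spherical functions on reductive algebraic groups over 𝔭-adic fields*,
  Publ. Math. IHÉS 18 (1963), §§6, 8.
* G. Shimura, *Introduction to the arithmetic theory of automorphic functions* (1971), Thm. 3.21
  [ShimuraIATAF1971].
* I. G. Macdonald, *Symmetric functions and Hall polynomials*, 2nd ed. (1995), Ch. V, §3
  [Macdonald1995].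
-/

noncomputable section

open scoped Pointwise MatrixGroups
open MulAction ValuativeRel Matrix Finset MonoidAlgebra Representation
  Literature.LinearAlgebra.Matrix.Echelon

namespace Literature.NumberTheory.Automorphic

variable {F : Type*} [Field F] [ValuativeRel F] {n : ℕ}

/-! ### Conjugating unipotents by the torus -/

omit [ValuativeRel F] in
/-- `d u d⁻¹ ∈ U` for `u ∈ U` upper unitriangular and `d = ϖ^m` diagonal. [folklore] -/
theorem zpowDiagGL_mul_mul_inv_mem_upperUnitriangular {ϖ : F} (hϖ : ϖ ≠ 0) (m : Fin n → ℤ)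
    {u : GL (Fin n) F} (hu : u ∈ upperUnitriangular (Fin n) F) :
    zpowDiagGL hϖ m * u * (zpowDiagGL hϖ m)⁻¹ ∈ upperUnitriangular (Fin n) F := by
  rw [mem_upperUnitriangular_iff] at hu ⊢
  rw [← zpowDiagGL_neg]
  refine ⟨?_, fun i => ?_⟩
  · rw [Units.val_mul, Units.val_mul]
    exact ((blockTriangular_zpowDiagGL hϖ m).mul hu.1).mul (blockTriangular_zpowDiagGL hϖ (-m))
  · rw [Units.val_mul, Units.val_mul, coe_zpowDiagGL, coe_zpowDiagGL, Matrix.mul_diagonal,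
      Matrix.diagonal_mul, hu.2 i, mul_one, Pi.neg_apply, _root_.zpow_neg, mul_inv_cancel₀]
    exact zpow_ne_zero _ hϖ

/-! ### The Iwasawa exponent `e(g)` -/

section Iwasawa

variable [IsDiscreteValuationRing 𝒪[F]] {ϖ : F} (hϖ : IsUniformizingElement ϖ)
include hϖ

/-- Iwasawa decomposition with the exponent quantified first. [folklore] -/
theorem exists_iwasawaExp (g : GL (Fin n) F) :
    ∃ m : Fin n → ℤ, ∃ u ∈ upperUnitriangular (Fin n) F, ∃ k ∈ glInt n F,
      g = u * zpowDiagGL hϖ.ne_zero m * k := by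
  obtain ⟨u, hu, m, k, hk, h⟩ := exists_unipotent_mul_zpowDiagGL_mul_glInt hϖ g
  exact ⟨m, u, hu, k, hk, h⟩

/-- The **Iwasawa exponent** `e(g) ∈ ℤⁿ` of `g ∈ GL_n(F)`: the unique `m` with `g = u ϖ^m k`,
`u` upper unitriangular, `k ∈ GL_n(𝒪)` (`exists_unipotent_mul_zpowDiagGL_mul_glInt`,
`zpowDiagGL_unique` of `IwasawaDecompositionGL`): the index of the `U`–`K` double coset of `g`
(Cartier, Corvallis 1979, §IV.2: `G = U A K`). [folklore] -/
def iwasawaExp (g : GL (Fin n) F) : Fin n → ℤ :=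
  (exists_iwasawaExp hϖ g).choose

/-- The defining property of `iwasawaExp`. [folklore] -/
theorem iwasawaExp_spec (g : GL (Fin n) F) :
    ∃ u ∈ upperUnitriangular (Fin n) F, ∃ k ∈ glInt n F,
      g = u * zpowDiagGL hϖ.ne_zero (iwasawaExp hϖ g) * k :=
  (exists_iwasawaExp hϖ g).choose_spec

/-- **Uniqueness**: any Iwasawa factorisation computes `iwasawaExp`. [folklore] -/
theorem iwasawaExp_eq {g u k : GL (Fin n) F} {m : Fin n → ℤ}
    (hu : u ∈ upperUnitriangular (Fin n) F) (hk : k ∈ glInt n F)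
    (h : g = u * zpowDiagGL hϖ.ne_zero m * k) : iwasawaExp hϖ g = m := by
  obtain ⟨u', hu', k', hk', h'⟩ := iwasawaExp_spec hϖ g
  exact zpowDiagGL_unique hϖ hu' hu hk' hk (h'.symm.trans h)

/-- `e(g k) = e(g)` for `k ∈ K`: the exponent is a function on `G ⧸ K`. [folklore] -/
theorem iwasawaExp_mul_of_mem_glInt (g : GL (Fin n) F) {k : GL (Fin n) F} (hk : k ∈ glInt n F) :
    iwasawaExp hϖ (g * k) = iwasawaExp hϖ g := by
  obtain ⟨u, hu, k', hk', h⟩ := iwasawaExp_spec hϖ g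
  refine iwasawaExp_eq hϖ hu (Subgroup.mul_mem _ hk' hk) ?_
  conv_lhs => rw [h]
  rw [mul_assoc]

/-- Equal cosets have equal exponents. [folklore] -/
theorem iwasawaExp_eq_of_coe_eq {g g' : GL (Fin n) F}
    (h : (g : GL (Fin n) F ⧸ glInt n F) = g') : iwasawaExp hϖ g = iwasawaExp hϖ g' := by
  rw [QuotientGroup.eq] at h
  have : g' = g * (g⁻¹ * g') := by rw [mul_inv_cancel_left]
  rw [this, iwasawaExp_mul_of_mem_glInt hϖ g h]

/-- `e(x.out) ` only depends on the coset `x`; in particular `e((gK).out) = e(g)`. [folklore] -/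
theorem iwasawaExp_out_coe (g : GL (Fin n) F) :
    iwasawaExp hϖ ((g : GL (Fin n) F ⧸ glInt n F).out) = iwasawaExp hϖ g :=
  iwasawaExp_eq_of_coe_eq hϖ (QuotientGroup.out_eq' _)

/-- `e(u ϖ^m k) = m`. [folklore] -/
theorem iwasawaExp_unipotent_mul_zpowDiagGL_mul_glInt {u k : GL (Fin n) F}
    (hu : u ∈ upperUnitriangular (Fin n) F) (m : Fin n → ℤ) (hk : k ∈ glInt n F) :
    iwasawaExp hϖ (u * zpowDiagGL hϖ.ne_zero m * k) = m :=
  iwasawaExp_eq hϖ hu hk rfl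

/-- `e(1) = 0`. [folklore] -/
theorem iwasawaExp_one : iwasawaExp hϖ (1 : GL (Fin n) F) = 0 :=
  iwasawaExp_eq hϖ (Subgroup.one_mem _) (Subgroup.one_mem _)
    (by rw [zpowDiagGL_zero, mul_one, mul_one])

/-- `e(k) = 0` for `k ∈ K`. [folklore] -/
theorem iwasawaExp_of_mem_glInt {k : GL (Fin n) F} (hk : k ∈ glInt n F) : iwasawaExp hϖ k = 0 := by
  rw [← one_mul k, iwasawaExp_mul_of_mem_glInt hϖ 1 hk, iwasawaExp_one]

/-- **Additivity along the Borel**: `e(u ϖ^m g) = m + e(g)` for `u ∈ U` — the torus parts of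
Iwasawa representatives multiply (Cartier, Corvallis 1979, proof of Thm. 4.1, step (a)).
[folklore] -/
theorem iwasawaExp_unipotent_mul_zpowDiagGL_mul {u : GL (Fin n) F}
    (hu : u ∈ upperUnitriangular (Fin n) F) (m : Fin n → ℤ) (g : GL (Fin n) F) :
    iwasawaExp hϖ (u * zpowDiagGL hϖ.ne_zero m * g) = m + iwasawaExp hϖ g := by
  obtain ⟨u', hu', k', hk', h⟩ := iwasawaExp_spec hϖ g
  set m' := iwasawaExp hϖ g
  refine iwasawaExp_eq hϖ (Subgroup.mul_mem _ hu
    (zpowDiagGL_mul_mul_inv_mem_upperUnitriangular hϖ.ne_zero m hu')) hk' ?_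
  rw [h, zpowDiagGL_add]
  group

/-- `e(u ϖ^ε) = ε` for `u ∈ U` and `ε ∈ ℕⁿ` (`piPowGL`). [folklore] -/
theorem iwasawaExp_unipotent_mul_piPowGL {u : GL (Fin n) F}
    (hu : u ∈ upperUnitriangular (Fin n) F) (ε : Fin n → ℕ) :
    iwasawaExp hϖ (u * piPowGL hϖ.ne_zero ε) = fun i => (ε i : ℤ) :=
  iwasawaExp_eq hϖ hu (Subgroup.one_mem _) (by rw [zpowDiagGL_natCast, mul_one])

end Iwasawa

/-! ### The weight `q^{-⟨ν, e⟩}` -/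

section Weight

/-- The twisting exponent `⟨ν, e⟩ = ∑_i (n - 1 - i) e_i` (`0`-indexed `i`; `ν = ρ + (n-1)/2`,
`ρ` the half-sum of positive roots of `GL_n`). [folklore] -/
def satakeTwistExp (e : Fin n → ℤ) : ℤ := ∑ i : Fin n, ((n : ℤ) - 1 - (i : ℕ)) * e i

/-- `⟨ν, a + b⟩ = ⟨ν, a⟩ + ⟨ν, b⟩`. [folklore] -/
theorem satakeTwistExp_add (a b : Fin n → ℤ) :
    satakeTwistExp (a + b) = satakeTwistExp a + satakeTwistExp b := by
  simp only [satakeTwistExp, Pi.add_apply, mul_add, Finset.sum_add_distrib]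

/-- `⟨ν, 0⟩ = 0`. [folklore] -/
@[simp]
theorem satakeTwistExp_zero : satakeTwistExp (0 : Fin n → ℤ) = 0 := by
  simp [satakeTwistExp]

/-- The weight `q^{-⟨ν, e⟩}` of the exponent `e` (a character of `ℤⁿ` for `q ≠ 0`). [folklore] -/
def satakeWeight (q : ℂ) (e : Fin n → ℤ) : ℂ := q ^ (-satakeTwistExp e)

/-- Multiplicativity of the weight. [folklore] -/
theorem satakeWeight_add {q : ℂ} (hq : q ≠ 0) (a b : Fin n → ℤ) :
    satakeWeight q (a + b) = satakeWeight q a * satakeWeight q b := by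
  rw [satakeWeight, satakeWeight, satakeWeight, satakeTwistExp_add, neg_add, zpow_add₀ hq]

/-- The weight of `0` is `1`. [folklore] -/
@[simp]
theorem satakeWeight_zero (q : ℂ) : satakeWeight q (0 : Fin n → ℤ) = 1 := by
  rw [satakeWeight, satakeTwistExp_zero, neg_zero, zpow_zero]

/-- The weight is non-zero for `q ≠ 0`. [folklore] -/
theorem satakeWeight_ne_zero {q : ℂ} (hq : q ≠ 0) (e : Fin n → ℤ) : satakeWeight q e ≠ 0 :=
  zpow_ne_zero _ hq

end Weight

/-! ### The Satake transform -/

/-- `q = #𝓀 ≠ 0` in `ℂ` for a finite residue field. [folklore] -/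
theorem natCard_residueField_ne_zero [Finite 𝓀[F]] : ((Nat.card 𝓀[F] : ℕ) : ℂ) ≠ 0 :=
  Nat.cast_ne_zero.2 Nat.card_pos.ne'

section Transform

variable [IsDiscreteValuationRing 𝒪[F]] {ϖ : F} (hϖ : IsUniformizingElement ϖ)

include hϖ in
/-- The **Satake transform on vectors**: the `ℂ`-linear map `ℂ[G ⧸ K] → ℂ[ℤⁿ]`,
`[γ] ↦ q^{-⟨ν, e(γ)⟩} x^{e(γ)}` with `e(γ)` the Iwasawa exponent of the coset `γ`. [folklore] -/
def satakeVec :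
    MonoidAlgebra ℂ (GL (Fin n) F ⧸ glInt n F) →ₗ[ℂ] AddMonoidAlgebra ℂ (Fin n → ℤ) :=
  Finsupp.linearCombination ℂ (fun γ : GL (Fin n) F ⧸ glInt n F =>
      AddMonoidAlgebra.single (iwasawaExp hϖ γ.out)
        (satakeWeight (Nat.card 𝓀[F] : ℂ) (iwasawaExp hϖ γ.out))) ∘ₗ
    (MonoidAlgebra.coeffLinearEquiv ℂ).toLinearMap

/-- `satakeVec` on a basis vector `[γ]`. [folklore] -/
theorem satakeVec_single (γ : GL (Fin n) F ⧸ glInt n F) (c : ℂ) :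
    satakeVec hϖ (single γ c) = AddMonoidAlgebra.single (iwasawaExp hϖ γ.out)
      (c * satakeWeight (Nat.card 𝓀[F] : ℂ) (iwasawaExp hϖ γ.out)) := by
  simp [satakeVec, Finsupp.linearCombination_single]

/-- `satakeVec` on `[gK]` for `g ∈ G`. [folklore] -/
theorem satakeVec_single_coe (g : GL (Fin n) F) (c : ℂ) :
    satakeVec hϖ (single (g : GL (Fin n) F ⧸ glInt n F) c) =
      AddMonoidAlgebra.single (iwasawaExp hϖ g)
        (c * satakeWeight (Nat.card 𝓀[F] : ℂ) (iwasawaExp hϖ g)) := by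
  rw [satakeVec_single, iwasawaExp_out_coe]

/-- `satakeVec` as a sum over the support. [folklore] -/
theorem satakeVec_apply (x : MonoidAlgebra ℂ (GL (Fin n) F ⧸ glInt n F)) :
    satakeVec hϖ x = ∑ γ ∈ x.coeff.support, x.coeff γ • AddMonoidAlgebra.single
      (iwasawaExp hϖ γ.out) (satakeWeight (Nat.card 𝓀[F] : ℂ) (iwasawaExp hϖ γ.out)) := by
  simp [satakeVec, Finsupp.linearCombination_apply, Finsupp.sum]

/-- The Satake transform of `[K]` is `1`. [folklore] -/
theorem satakeVec_single_one :
    satakeVec hϖ (single ((1 : GL (Fin n) F) : GL (Fin n) F ⧸ glInt n F) 1) = 1 := by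
  rw [satakeVec_single_coe, iwasawaExp_one, satakeWeight_zero, one_mul, AddMonoidAlgebra.one_def]

variable [Finite 𝓀[F]]

/-- **Translation by a Borel element multiplies by a monomial**: for `b = u ϖ^m` (`u ∈ U`) and
every `x ∈ ℂ[G ⧸ K]`, `satakeVec (π(b) x) = q^{-⟨ν, m⟩} x^m · satakeVec x`. [folklore] -/
theorem satakeVec_ofMulAction_unipotent_mul_zpowDiagGL {u : GL (Fin n) F}
    (hu : u ∈ upperUnitriangular (Fin n) F) (m : Fin n → ℤ)
    (x : MonoidAlgebra ℂ (GL (Fin n) F ⧸ glInt n F)) :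
    satakeVec hϖ (ofMulAction ℂ (GL (Fin n) F) (GL (Fin n) F ⧸ glInt n F)
        (u * zpowDiagGL hϖ.ne_zero m) x) =
      AddMonoidAlgebra.single m (satakeWeight (Nat.card 𝓀[F] : ℂ) m) * satakeVec hϖ x := by
  suffices h : satakeVec hϖ ∘ₗ ofMulAction ℂ (GL (Fin n) F) (GL (Fin n) F ⧸ glInt n F)
        (u * zpowDiagGL hϖ.ne_zero m) =
      LinearMap.mulLeft ℂ (AddMonoidAlgebra.single m (satakeWeight (Nat.card 𝓀[F] : ℂ) m)) ∘ₗ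
        satakeVec hϖ from LinearMap.congr_fun h x
  refine MonoidAlgebra.lhom_ext' fun γ => LinearMap.ext fun c => ?_
  induction γ using QuotientGroup.induction_on with
  | H g =>
    simp only [LinearMap.comp_apply, MonoidAlgebra.lsingle_apply, ofMulAction_single,
      LinearMap.mulLeft_apply, MulAction.Quotient.smul_coe, smul_eq_mul, satakeVec_single_coe,
      iwasawaExp_unipotent_mul_zpowDiagGL_mul hϖ hu, AddMonoidAlgebra.single_mul_single]
    rw [satakeWeight_add natCard_residueField_ne_zero]
    congr 1
    ring

/-- **Translation by a representative**: `satakeVec (π(γ̃) s) = q^{-⟨ν, e(γ)⟩} x^{e(γ)} · satakeVec s`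
for a `K`-invariant `s` (replace `γ̃ = u ϖ^{e} k` by its Borel part). [folklore] -/
theorem satakeVec_ofMulAction_out {s : MonoidAlgebra ℂ (GL (Fin n) F ⧸ glInt n F)}
    (hs : ∀ a ∈ glInt n F, ofMulAction ℂ (GL (Fin n) F) (GL (Fin n) F ⧸ glInt n F) a s = s)
    (γ : GL (Fin n) F ⧸ glInt n F) :
    satakeVec hϖ (ofMulAction ℂ (GL (Fin n) F) (GL (Fin n) F ⧸ glInt n F) γ.out s) =
      AddMonoidAlgebra.single (iwasawaExp hϖ γ.out)
        (satakeWeight (Nat.card 𝓀[F] : ℂ) (iwasawaExp hϖ γ.out)) * satakeVec hϖ s := by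
  obtain ⟨u, hu, k, hk, h⟩ := iwasawaExp_spec hϖ γ.out
  set m := iwasawaExp hϖ γ.out
  conv_lhs => rw [h, map_mul, Module.End.mul_apply, hs k hk]
  exact satakeVec_ofMulAction_unipotent_mul_zpowDiagGL hϖ hu m s

/-- **The Satake transform** `𝒮 : ℋ(GL_n(F), GL_n(𝒪)) →ₐ[ℂ] ℂ[ℤⁿ]`,
`𝒮(T) = ∑_{γ ∈ G/K} (T [K])(γ) q^{-⟨ν, e(γ)⟩} x^{e(γ)}` — Cartier's
`(Sf)(t) = δ(t)^{1/2} ∫_U f(tu) du` (Corvallis 1979, §IV.2, (4.2.3)) on `f = T [K]`, in an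
integral normalisation (`satakeWeight`).  It is an algebra homomorphism: unital by
`satakeVec_single_one`, multiplicative because `(S T) [K] = ∑_γ (T [K])(γ) π(γ̃) (S [K])`
(`heckeAlgebra.toVector_mul_eq_sum`) and translation by the Borel part `u ϖ^{e(γ)}` of `γ̃`
multiplies the transform by the monomial of `γ` (`satakeVec_ofMulAction_out`) — step (a) of the
proof of Cartier's Thm. 4.1 (Satake 1963, §6). [cite: CartierCorvallis1979, §IV.2 (4.2.3)] -/
def satakeTransform :
    heckeAlgebra ℂ (GL (Fin n) F) (glInt n F) →ₐ[ℂ] AddMonoidAlgebra ℂ (Fin n → ℤ) :=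
  AlgHom.ofLinearMap (satakeVec hϖ ∘ₗ heckeAlgebra.toVector (glInt n F))
    (by rw [LinearMap.comp_apply, heckeAlgebra.toVector_one, satakeVec_single_one])
    (by
      intro S T
      simp only [LinearMap.comp_apply]
      rw [heckeAlgebra.toVector_mul_eq_sum, map_sum, mul_comm, satakeVec_apply hϖ
        (heckeAlgebra.toVector (glInt n F) T), Finset.sum_mul]
      refine Finset.sum_congr rfl fun γ _ => ?_
      rw [map_smul, satakeVec_ofMulAction_out hϖ
        (fun a ha => heckeAlgebra.ofMulAction_toVector (glInt n F) S ha), smul_mul_assoc])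

/-- Unfolding lemma: `𝒮(T) = satakeVec (T [K])`. [folklore] -/
theorem satakeTransform_apply (T : heckeAlgebra ℂ (GL (Fin n) F) (glInt n F)) :
    satakeTransform hϖ T = satakeVec hϖ (heckeAlgebra.toVector (glInt n F) T) :=
  rfl

variable [IsHeckeTriple (⊤ : Submonoid (GL (Fin n) F)) (glInt n F) (glInt n F)]

/-- `𝒮(T_g) = ∑_{α ∈ KgK/K} q^{-⟨ν, e(α)⟩} x^{e(α)}`. [folklore] -/
theorem satakeTransform_doubleCosetOperator (g : GL (Fin n) F) :
    satakeTransform hϖ (heckeAlgebra.doubleCosetOperator (glInt n F) g) =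
      ∑ α ∈ (finite_orbit_quotient (glInt n F) g).toFinset,
        AddMonoidAlgebra.single (iwasawaExp hϖ α.out)
          (satakeWeight (Nat.card 𝓀[F] : ℂ) (iwasawaExp hϖ α.out)) := by
  rw [satakeTransform_apply, heckeAlgebra.toVector_doubleCosetOperator,
    heckeAlgebra.doubleCosetIndicator_eq_sum, map_sum]
  refine Finset.sum_congr rfl fun α _ => ?_
  rw [satakeVec_single, one_mul]

end Transform

/-! ### The transform of `T_r` -/

section HeckeDiag

variable [IsDiscreteValuationRing 𝒪[F]] [Finite 𝓀[F]] {ϖ : F} (hϖ : IsUniformizingElement ϖ)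
  [IsHeckeTriple (⊤ : Submonoid (GL (Fin n) F)) (glInt n F) (glInt n F)]

omit [IsDiscreteValuationRing 𝒪[F]] [Finite 𝓀[F]] [IsHeckeTriple ⊤ (glInt n F) (glInt n F)] in
/-- **The exponent identity** behind the normalisation: for `#S = n - r` (`r ≤ n`),
`c(S) - ∑_{i ∉ S} (n - 1 - i) = -r(r-1)/2`, where `c(S) = #echelonPositions S` counts the free
entries of the coset representatives with pivot set `S` (from
`two_mul_card_echelonPositions_compl` of `ShintaniWhittakerFormula`). [folklore] -/
theorem card_echelonPositions_sub_sum (S : Finset (Fin n)) {r : ℕ} (hr : r ≤ n)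
    (hS : S.card = n - r) :
    ((echelonPositions S).card : ℤ) - ∑ i ∈ univ \ S, ((n : ℤ) - 1 - (i : ℕ)) =
      -((r * (r - 1) / 2 : ℕ) : ℤ) := by
  have hT : (univ \ S).card = r := by
    rw [Finset.card_sdiff_of_subset (subset_univ S), Finset.card_univ, Fintype.card_fin, hS]
    omega
  have h := two_mul_card_echelonPositions_compl (univ \ S)
  rw [sdiff_sdiff_right_self, Finset.inf_eq_inter, Finset.univ_inter, hT] at h
  -- `h : 2 c + 2 ∑_{i ∈ T} i + r (r + 1) = 2 r n`
  have h' : (2 * ((echelonPositions S).card : ℤ)) + 2 * ∑ i ∈ univ \ S, ((i : ℕ) : ℤ) +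
      r * (r + 1) = 2 * r * n := by exact_mod_cast h
  have hsum : ∑ i ∈ univ \ S, ((n : ℤ) - 1 - (i : ℕ)) =
      r * ((n : ℤ) - 1) - ∑ i ∈ univ \ S, ((i : ℕ) : ℤ) := by
    rw [Finset.sum_sub_distrib, Finset.sum_const, hT, nsmul_eq_mul]
  have h2 : ((r * (r - 1) / 2 : ℕ) : ℤ) * 2 = r * ((r : ℤ) - 1) := by
    have h3 : ((r * (r - 1) / 2 : ℕ) : ℤ) * 2 = ((r * (r - 1) : ℕ) : ℤ) := by
      exact_mod_cast Nat.div_mul_cancel (even_iff_two_dvd.mp (Nat.even_mul_pred_self r))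
    rw [h3]
    rcases Nat.eq_zero_or_pos r with rfl | hr0
    · simp
    · rw [Nat.cast_mul, Nat.cast_sub hr0, Nat.cast_one]
  rw [hsum]
  have key : 2 * (((echelonPositions S).card : ℤ) - (r * ((n : ℤ) - 1) -
      ∑ i ∈ univ \ S, ((i : ℕ) : ℤ))) = 2 * -((r * (r - 1) / 2 : ℕ) : ℤ) := by
    linear_combination h' + h2
  exact mul_left_cancel₀ two_ne_zero key

/-- **The Satake transform of `T_r`** (`r ≤ n`, `T_r = T_{diag(ϖ 1_r, 1_{n-r})}`):
`𝒮(T_r) = q^{-r(r-1)/2} ∑_{#t = r} x^{𝟙_t} = q^{-r(r-1)/2} e_r(x)`, the `r`-th elementary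
symmetric Laurent polynomial.  From the transversal `u_a ϖ^{ε_S}` (`#S = n - r`, `ā` an echelon
table, `q^{c(S)}` of them) of `K t_r K / K` (`bijOn_heckeTransversal`), `e(u_a ϖ^{ε_S}) = ε_S =
𝟙_{Sᶜ}` and `c(S) - ⟨ν, ε_S⟩ = -r(r-1)/2` (`card_echelonPositions_sub_sum`) — Tamagawa's
computation of `ω(T_r)` (Shimura (1971), Thm. 3.21; Macdonald (1995), Ch. V, (3.4); Cartier,
Corvallis 1979, §IV.2, Example). [cite: ShimuraIATAF1971, Thm. 3.21] -/
theorem satakeTransform_doubleCosetOperator_heckeDiag {r : ℕ} (hr : r ≤ n) :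
    satakeTransform hϖ (heckeAlgebra.doubleCosetOperator (glInt n F)
        (heckeDiag n (Units.mk0 ϖ hϖ.ne_zero) r)) =
      ((Nat.card 𝓀[F] : ℂ) ^ (r * (r - 1) / 2))⁻¹ •
        ∑ t ∈ Finset.powersetCard r (univ : Finset (Fin n)),
          AddMonoidAlgebra.single (fun i => if i ∈ t then (1 : ℤ) else 0) (1 : ℂ) := by
  classical
  haveI : Fintype 𝓀[F] := Fintype.ofFinite _
  have hq0 : ((Nat.card 𝓀[F] : ℕ) : ℂ) ≠ 0 := natCard_residueField_ne_zero
  have hqcard : (Fintype.card 𝓀[F] : ℂ) = (Nat.card 𝓀[F] : ℂ) := by rw [Nat.card_eq_fintype_card]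
  -- Step 1: the sum over the orbit is a sum over the transversal `{u_a ϖ^{ε_S}}`
  have hbij := bijOn_heckeTransversal (n := n) hϖ hr
  rw [satakeTransform_doubleCosetOperator]
  have himg : (finite_orbit_quotient (glInt n F) (heckeDiag n (Units.mk0 ϖ hϖ.ne_zero) r)).toFinset =
      (heckeTransversal (n := n) hϖ.ne_zero r).image
        (fun y : GL (Fin n) F => (y : GL (Fin n) F ⧸ glInt n F)) := by
    ext γ
    rw [Set.Finite.mem_toFinset, Finset.mem_image]
    constructor
    · intro hγ
      obtain ⟨y, hy, rfl⟩ := hbij.surjOn hγ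
      exact ⟨y, hy, rfl⟩
    · rintro ⟨y, hy, rfl⟩
      exact hbij.mapsTo hy
  rw [himg, Finset.sum_image fun x hx y hy h => hbij.injOn hx hy h, sum_heckeTransversal hϖ]
  -- Step 2: the exponent of a representative is `ε_S`
  have hrep : ∀ p : TransversalIndex n F r,
      iwasawaExp hϖ ((p.rep hϖ.ne_zero : GL (Fin n) F ⧸ glInt n F).out) =
        fun i => (epsOf p.1.1 i : ℤ) := by
    rintro ⟨⟨S, ā⟩, hS, h⟩
    rw [iwasawaExp_out_coe]
    change iwasawaExp hϖ (heckeRep hϖ.ne_zero h) = _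
    rw [heckeRep_eq_mul, iwasawaExp_unipotent_mul_piPowGL hϖ (echelonGL_mem_upperUnitriangular h)]
  simp_rw [hrep]
  -- Step 3: count the tables with a given pivot set
  rw [sum_transversalIndex_of_fst r (fun S : Finset (Fin n) =>
    AddMonoidAlgebra.single (fun i => (epsOf S i : ℤ))
      (satakeWeight (Nat.card 𝓀[F] : ℂ) fun i => (epsOf S i : ℤ)))]
  -- Step 4: reindex `S ↦ univ \ S` and evaluate the weights
  rw [Finset.smul_sum]
  refine Finset.sum_nbij' (fun S => univ \ S) (fun t => univ \ t) ?_ ?_ ?_ ?_ ?_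
  · intro S hS
    rw [Finset.mem_filter] at hS
    rw [Finset.mem_powersetCard, Finset.card_sdiff_of_subset (subset_univ S),
      Finset.card_univ, Fintype.card_fin, hS.2]
    exact ⟨Finset.sdiff_subset, by omega⟩
  · intro t ht
    rw [Finset.mem_powersetCard] at ht
    rw [Finset.mem_filter, Finset.card_sdiff_of_subset (subset_univ t),
      Finset.card_univ, Fintype.card_fin, ht.2]
    exact ⟨Finset.mem_univ _, by omega⟩
  · intro S _
    rw [sdiff_sdiff_right_self, Finset.inf_eq_inter, Finset.univ_inter]
  · intro t _
    rw [sdiff_sdiff_right_self, Finset.inf_eq_inter, Finset.univ_inter]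
  · intro S hS
    rw [Finset.mem_filter] at hS
    have heps : (fun i => (epsOf S i : ℤ)) = fun i => if i ∈ univ \ S then (1 : ℤ) else 0 := by
      funext i
      simp only [epsOf, Finset.mem_sdiff, Finset.mem_univ, true_and]
      split_ifs <;> simp
    rw [heps, ← Nat.cast_smul_eq_nsmul ℂ, Nat.cast_pow, hqcard, AddMonoidAlgebra.smul_single,
      AddMonoidAlgebra.smul_single, smul_eq_mul, smul_eq_mul, mul_one]
    congr 1
    -- the weight: `q^{c(S)} q^{-⟨ν, ε_S⟩} = q^{-r(r-1)/2}`
    have hexp : satakeTwistExp (fun i => if i ∈ univ \ S then (1 : ℤ) else 0) =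
        ∑ i ∈ univ \ S, ((n : ℤ) - 1 - (i : ℕ)) := by
      rw [satakeTwistExp, ← Finset.sum_filter_add_sum_filter_not univ (fun i => i ∈ univ \ S)]
      rw [Finset.sum_eq_zero (s := univ.filter fun i => ¬ i ∈ univ \ S) (fun i hi => by
        rw [Finset.mem_filter] at hi; rw [if_neg hi.2, mul_zero]), add_zero]
      have : univ.filter (fun i : Fin n => i ∈ univ \ S) = univ \ S := by
        ext i; simp
      rw [this]
      exact Finset.sum_congr rfl fun i hi => by rw [if_pos hi, mul_one]
    rw [satakeWeight, hexp, ← zpow_natCast, ← zpow_add₀ hq0, ← zpow_natCast, ← _root_.zpow_neg,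
      show ((echelonPositions S).card : ℤ) + -∑ i ∈ univ \ S, ((n : ℤ) - 1 - (i : ℕ)) =
        -((r * (r - 1) / 2 : ℕ) : ℤ) by rw [← sub_eq_add_neg, card_echelonPositions_sub_sum S hr hS.2]]

end HeckeDiag

end Literature.NumberTheory.Automorphic
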